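import Summits.CriticalPhenomena.PercolationContinuityZ3.Theorems.PercNearOneGluingNoHeavyLowerTailKnQuestion8CoefficientwiseCoreClassKernelMixBouquet

/-!
# Exact blue-cluster levels of a bouquet are product levels (L5 link, part 1: `GenLevels`)

Support file (`--supports stmt-CriticalPhenomena-4575`, closed), prover `prim-cplus-coupling` (gen 67).  No notations, no named facts, no sorries;
standard axioms.  Memo `prim-cplus-coupling/A5-COUPLING-gen66.md` §7.2 (ii) and `A5-COUPLING-gen67.md` §1.

The two-type theorem (`Bouquet.HBundle.x2`, gen 66) is stated for the abstract LEVELS of a bouquet H-space (`HSpace.ProdLevel` chains of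
`CycleWords.IsLevel` / `SmallCycles.LoopLevel` / `SmallCycles.DigonLevel`).  The levels that occur in the bundle reduction of CONJECTURE IET are the
EXACT families `{x ∈ NF : Y(x) ∈ 𝒟}` where `Y` is the blue cluster of the hub and `𝒟` is an arbitrary up-closed family of vertex sets.  This file isolates
the property that makes the induction over the cycles of the bouquet work:
* `GenLevels H Y` : for every up-closed predicate `𝒟` on `Set ν`, the exact family `{x ∈ H.NF | 𝒟 (Y x)}` is a level of `H`;
* `genLevels_unit` (any `Y`), and the three gluing steps `genLevels_consCycle`, `genLevels_consLoop`, `genLevels_consDigon` for the cluster map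
  `Y'(x, w) = Y(x) ∪ Y_t(w)` of the bigger bouquet, where the blue-run set `Y_t` of the new cycle is antitone in the word, maximal at the two single-hub-red words
  with blue interior, and minimal at every word with both hub letters red (the three facts of memo-66 §7.2 (ii)); fibres are then cycle levels and rows are exact
  families of the smaller bouquet for the SHIFTED family `𝒟_w = {S | S ∪ Y_t(w) ∈ 𝒟}` (memo-61 §3.3).
[cite: KozmaNitzan2024, Questions 8–9 (§5.5 p. 36) (context); Harris 1960; Kleitman 1966]
-/

namespace Summit.CriticalPhenomena.PercolationContinuityZ3.Theorems.Coefficientwise.BouquetLevels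

open Finset HSpace CycleWords CycleFactor SmallCycles ReducedKleitman Bouquet

variable {ν : Type*}

open Classical in
/-- `H` with cluster map `Y` GENERATES LEVELS: for every up-closed predicate `𝒟` on vertex sets, the exact family `{x ∈ NF | 𝒟 (Y x)}` is a level of `H`. -/
def GenLevels (H : HBundle) (Y : H.X → Set ν) : Prop :=
  ∀ 𝒟 : Set ν → Prop, (∀ S T : Set ν, S ⊆ T → 𝒟 S → 𝒟 T) → H.Level (H.NF.filter (fun x => 𝒟 (Y x)))

/-- The empty bouquet generates levels (every family is a level). -/
theorem genLevels_unit (Y : HBundle.unit.X → Set ν) : GenLevels HBundle.unit Y :=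
  fun _ _ => trivial

open Classical in
/-- In a level-generating bouquet the empty family is a level. -/
theorem level_empty {H : HBundle} {Y : H.X → Set ν} (hY : GenLevels H Y) : H.Level ∅ := by
  have h := hY (fun _ => False) (fun _ _ _ h => h)
  simpa using h

section Cycle

variable (α : Type) [Fintype α] [DecidableEq α] [Nonempty α]

omit [DecidableEq α] [Nonempty α] in
/-- The single-hub word `(R, ∅, B)` is not the full word. -/
theorem RB_ne_topW : ((true, ((∅ : Finset α), false)) : Bool × Finset α × Bool) ≠ topW α := by simp [topW]

omit [DecidableEq α] [Nonempty α] in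
/-- The single-hub word `(B, ∅, R)` is not the full word. -/
theorem BR_ne_topW : ((false, ((∅ : Finset α), true)) : Bool × Finset α × Bool) ≠ topW α := by simp [topW]

open Classical in
/-- **Gluing a cycle keeps `GenLevels`.**  If `H, Y` generates levels and the blue-run set `Yt` of the new cycle (a function of its word) is antitone,
below its value at the two single-hub-red words `(R,∅,B)`, `(B,∅,R)`, and minimal at every both-hubs-red word, then `H.consCycle α` with
`Y'(x,w) = Y x ∪ Yt w` generates levels.  Memo-66 §7.2 (ii). -/
theorem genLevels_consCycle (H : HBundle) (Y : H.X → Set ν) (hY : GenLevels H Y) (Yt : Bool × Finset α × Bool → Set ν)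
    (anti : ∀ w w' : Bool × Finset α × Bool, w ≤ w' → Yt w' ⊆ Yt w)
    (hRB : ∀ w, Yt w ⊆ Yt (true, (∅, false))) (hBR : ∀ w, Yt w ⊆ Yt (false, (∅, true)))
    (hRR : ∀ (μ : Finset α) (w : Bool × Finset α × Bool), Yt (true, (μ, true)) ⊆ Yt w) :
    GenLevels (H.consCycle α) (fun z => Y z.1 ∪ Yt z.2) := by
  intro 𝒟 h𝒟
  set W : Finset (H.X × (Bool × Finset α × Bool)) :=
    (H.NF ×ˢ (univ.erase (topW α))).filter (fun z => 𝒟 (Y z.1 ∪ Yt z.2)) with hW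
  have hmem : ∀ (x : H.X) (w : Bool × Finset α × Bool), (x, w) ∈ W ↔ x ∈ H.NF ∧ w ≠ topW α ∧ 𝒟 (Y x ∪ Yt w) := by
    intro x w
    rw [hW, mem_filter, mem_product, mem_erase]
    constructor
    · rintro ⟨⟨hx, hw, -⟩, hD⟩; exact ⟨hx, hw, hD⟩
    · rintro ⟨hx, hw, hD⟩; exact ⟨⟨hx, hw, mem_univ _⟩, hD⟩
  show ProdLevel H.Level IsLevel W
  refine ⟨fun x => ?_, fun v => ?_⟩
  · -- fibres are cycle levels
    have hf : ∀ w, w ∈ fibL W x ↔ x ∈ H.NF ∧ w ≠ topW α ∧ 𝒟 (Y x ∪ Yt w) := fun w => by rw [mem_fibL, hmem]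
    refine ⟨?_, ?_, ?_, ?_⟩
    · intro w w' hle hw
      rw [mem_coe, hf] at hw ⊢
      refine ⟨hw.1, fun h => hw.2.1 (le_antisymm (le_topW w) (h ▸ hle)), h𝒟 _ _ ?_ hw.2.2⟩
      exact Set.union_subset_union_right _ (anti _ _ hle)
    · intro h; exact ((hf _).mp h).2.1 rfl
    · rintro ⟨w₀, hw₀⟩
      obtain ⟨hx, -, hD⟩ := (hf w₀).mp hw₀
      exact ⟨(hf _).mpr ⟨hx, RB_ne_topW α, h𝒟 _ _ (Set.union_subset_union_right _ (hRB w₀)) hD⟩,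
        (hf _).mpr ⟨hx, BR_ne_topW α, h𝒟 _ _ (Set.union_subset_union_right _ (hBR w₀)) hD⟩⟩
    · rintro ⟨μ, hμ⟩ w hw
      obtain ⟨hx, -, hD⟩ := (hf _).mp hμ
      exact (hf _).mpr ⟨hx, hw, h𝒟 _ _ (Set.union_subset_union_right _ (hRR μ w)) hD⟩
  · -- rows are exact families of `H` for the shifted predicate
    by_cases hv : v = topW α
    · have he : fibR W v = ∅ := by
        ext x
        simp only [mem_fibR, notMem_empty, iff_false]
        intro h; exact ((hmem x v).mp h).2.1 hv
      rw [he]; exact level_empty hY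
    · have he : fibR W v = H.NF.filter (fun x => 𝒟 (Y x ∪ Yt v)) := by
        ext x
        rw [mem_fibR, hmem, mem_filter]
        exact ⟨fun h => ⟨h.1, h.2.2⟩, fun h => ⟨h.1, hv, h.2⟩⟩
      rw [he]
      exact hY (fun S => 𝒟 (S ∪ Yt v)) (fun S T hST hS => h𝒟 _ _ (Set.union_subset_union_left _ hST) hS)

end Cycle

open Classical in
/-- **Gluing a loop keeps `GenLevels`** (any `Yt`). -/
theorem genLevels_consLoop (H : HBundle) (Y : H.X → Set ν) (hY : GenLevels H Y) (Yt : Bool → Set ν) :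
    GenLevels H.consLoop (fun z => Y z.1 ∪ Yt z.2) := by
  intro 𝒟 h𝒟
  set W : Finset (H.X × Bool) := (H.NF ×ˢ ({false} : Finset Bool)).filter (fun z => 𝒟 (Y z.1 ∪ Yt z.2)) with hW
  have hmem : ∀ (x : H.X) (w : Bool), (x, w) ∈ W ↔ x ∈ H.NF ∧ w = false ∧ 𝒟 (Y x ∪ Yt w) := by
    intro x w
    rw [hW, mem_filter, mem_product, mem_singleton]
    exact ⟨fun h => ⟨h.1.1, h.1.2, h.2⟩, fun h => ⟨⟨h.1, h.2.1⟩, h.2.2⟩⟩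
  show ProdLevel H.Level LoopLevel W
  refine ⟨fun x => ?_, fun v => ?_⟩
  · intro w hw
    rw [mem_fibL, hmem] at hw
    exact mem_singleton.mpr hw.2.1
  · by_cases hv : v = false
    · have he : fibR W v = H.NF.filter (fun x => 𝒟 (Y x ∪ Yt v)) := by
        ext x
        rw [mem_fibR, hmem, mem_filter]
        exact ⟨fun h => ⟨h.1, h.2.2⟩, fun h => ⟨h.1, hv, h.2⟩⟩
      rw [he]
      exact hY (fun S => 𝒟 (S ∪ Yt v)) (fun S T hST hS => h𝒟 _ _ (Set.union_subset_union_left _ hST) hS)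
    · have he : fibR W v = ∅ := by
        ext x
        simp only [mem_fibR, notMem_empty, iff_false]
        intro h; exact hv ((hmem x v).mp h).2.1
      rw [he]; exact level_empty hY

open Classical in
/-- **Gluing a digon keeps `GenLevels`**, provided every non-full word of the digon sees at least what any word sees (`Yt` is maximal off `(R,R)`). -/
theorem genLevels_consDigon (H : HBundle) (Y : H.X → Set ν) (hY : GenLevels H Y) (Yt : Bool × Bool → Set ν)
    (hYt : ∀ w w' : Bool × Bool, w ≠ (true, true) → Yt w' ⊆ Yt w) :
    GenLevels H.consDigon (fun z => Y z.1 ∪ Yt z.2) := by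
  intro 𝒟 h𝒟
  set W : Finset (H.X × (Bool × Bool)) :=
    (H.NF ×ˢ (univ.erase (true, true))).filter (fun z => 𝒟 (Y z.1 ∪ Yt z.2)) with hW
  have hmem : ∀ (x : H.X) (w : Bool × Bool), (x, w) ∈ W ↔ x ∈ H.NF ∧ w ≠ (true, true) ∧ 𝒟 (Y x ∪ Yt w) := by
    intro x w
    rw [hW, mem_filter, mem_product, mem_erase]
    constructor
    · rintro ⟨⟨hx, hw, -⟩, hD⟩; exact ⟨hx, hw, hD⟩
    · rintro ⟨hx, hw, hD⟩; exact ⟨⟨hx, hw, mem_univ _⟩, hD⟩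
  show ProdLevel H.Level DigonLevel W
  refine ⟨fun x => ?_, fun v => ?_⟩
  · have hf : ∀ w, w ∈ fibL W x ↔ x ∈ H.NF ∧ w ≠ (true, true) ∧ 𝒟 (Y x ∪ Yt w) := fun w => by rw [mem_fibL, hmem]
    by_cases hne : (fibL W x).Nonempty
    · right
      obtain ⟨w₀, hw₀⟩ := hne
      obtain ⟨hx, _, hD⟩ := (hf w₀).mp hw₀
      ext w
      rw [hf, mem_erase]
      constructor
      · rintro ⟨-, hw, -⟩; exact ⟨hw, mem_univ _⟩
      · rintro ⟨hw, -⟩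
        exact ⟨hx, hw, h𝒟 _ _ (Set.union_subset_union_right _ (hYt w w₀ hw)) hD⟩
    · left; exact not_nonempty_iff_eq_empty.mp hne
  · by_cases hv : v = (true, true)
    · have he : fibR W v = ∅ := by
        ext x
        simp only [mem_fibR, notMem_empty, iff_false]
        intro h; exact ((hmem x v).mp h).2.1 hv
      rw [he]; exact level_empty hY
    · have he : fibR W v = H.NF.filter (fun x => 𝒟 (Y x ∪ Yt v)) := by
        ext x
        rw [mem_fibR, hmem, mem_filter]
        exact ⟨fun h => ⟨h.1, h.2.2⟩, fun h => ⟨h.1, hv, h.2⟩⟩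
      rw [he]
      exact hY (fun S => 𝒟 (S ∪ Yt v)) (fun S T hST hS => h𝒟 _ _ (Set.union_subset_union_left _ hST) hS)

end Summit.CriticalPhenomena.PercolationContinuityZ3.Theorems.Coefficientwise.BouquetLevels
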